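import Literature.NumberTheory.EllipticCurves.FormalGroupChart
import HarnessLib

/-!
# The kernel of reduction of `y² + xy = x³ − x² − 2x − 1` at a prime above `2`: halving in the chart and the
# CM descent of `E₁`-membership (the (N1) input of the `q = 2` theta/Coleman bridge — proofs only)

Topic `NumberTheory/EllipticCurves` (theorems only; no definition, no named fact, no instance).  Cell `bsd-print-cf2`,
width seat `bsd-line-cf2-p1-w5` g17, piece B9 (N1) of the LEAD's v14.9 plan: the hypothesis
`hU : ∀ m, U m ∈ kernel …` of `exists_unit_relColemanSeries_eq_subst_subst_of_divisionPoints` (the reading points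
`U m = ι_v ξ(u_{m+1})` of the `𝔭^{m+1}`-division points LIE IN `E₁`).

Let `(F, w)` be a valued field with `w 2 < 1` and `V` the Weierstrass equation `[1, −1, 0, −2, −1]` (conductor `49`,
CM by `ℤ[(1 + √−7)/2]`, the lane's model at the split prime `𝔭 = (α₀)`, `α₀² − α₀ + 2 = 0`); `E₁ = kernel w V` is the
tree's kernel of reduction (`FormalGroupChart.kernel`: `O` and the points `(x, y)` with `1 < w x`).  The reduction is
`ȳ² + x̄ȳ = x̄³ + x̄² + 1`, ORDINARY with the single nonzero `2`-torsion point `(0, 1)`; everything below is the chart-level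
shadow of "`E(M) → Ẽ(k)` is a homomorphism with `Ẽ[2](k) = {O, (0,1)}`", proved directly from Mathlib's chord–tangent
formulas (no reduction map, no residue field):

* §1 ★ `val_lt_one_of_not_mem_of_add_self_mem` — **halving**: `P = (x, y) ∉ E₁` with `2P ∈ E₁` forces `w x < 1` and
  `w (y + 1) < 1` (`P ≡ (0, 1)`);  ★ `add_mem_kernel_of_val_lt_one` — two points `≡ (0, 1)` add into `E₁`
  (the chord/tangent slope through them has `w > 1`: its numerator is `≡ −1`, its denominator `2y + x`, `y₁ + y₂ + x₁` is `≡ 0`).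
* §2 ★★ `mem_kernel_of_forall_not_mem` — **descent**: if `2^N P₀ = O`, `R ≠ O`, `2R = O`, `R ∉ E₁` and NO translate
  `2^i P₀ + R` (`i < N`) lies in `E₁`, then `P₀ ∈ E₁` (minimal `j` with `2^j P₀ ∈ E₁`, halving, and §1 at `2^{j−1}P₀ + R`).
* §3 ★★★ `forall_mem_kernel_of_cmDescent` — **(N1) in abstract form**: points `Y 0, …, Y m` with `2^{n+1} Y n = O`, a point
  `R ≠ O` with `2R = O`, `R ∉ E₁`, `Y 0 + R ∉ E₁`, and the DESCENT HYPOTHESIS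
  `k • Y (n+1) + R ∈ E₁ → k • Y n + R ∈ E₁` (`0 < k < 2^{n+2}`, `n < m`) give `Y n ∈ E₁` for all `n ≤ m`.
  In the lane: `Y n = ι_v ξ(u_{n+1})`, `R = ι_v ξ(ū)` (`ū` a primitive `𝔭̄`-division point), and the descent hypothesis is
  ONE application of the `[π]`-coherence `P([π]_{P′} z(U′)) = ι_v ξ(π₀ z)` (`CMFormalActionLaneCoherence`, B10d) at the
  reading `U′ = ι_v ξ(k u_{n+2} + ū)` (`π₀ u_{n+2} ≡ u_{n+1}`, `π₀ ū ≡ ū (mod L)`), whose left side lies in `E₁` because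
  `P(·)` does; `R ∉ E₁` is the same coherence at `ū` against `[π]_{P′}` killing the `2`-torsion of `E₁`; NO Deuring
  lifting, no `2`-division polynomial and no count of `E[2ⁿ]` is used.

No summit statement is proved; BSD is not proved by any of this.

## Usage note (elaboration)

`kernel w V` is an `AddSubgroup` whose carrier is `{P | ∀ {x y h}, P = .some x y h → 1 < w x}`, so a membership
`P ∈ kernel w V` unfolds to a `∀` with implicit binders.  Consume the theorems below by DIRECT application
(`exact Cm7Kernel.mem_kernel_of_cmDescent hV7 h2 …`, term mode, or as an argument of another lemma); re-binding a
membership through an untyped `have := …` or closing a goal with `exact h` for a `have`/`rw`-produced local `h` can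
trigger the implicit-lambda elaborator (`… = some ?x ?y ?h → 1 < w ?x`) — use `assumption` or pass `h` as an argument instead.

## References
* [SilvermanAEC2009] J. H. Silverman, *The Arithmetic of Elliptic Curves*, 2nd ed. (2009), III.2.3 (group law), VII.2.1–VII.2.2
  (`E₁` and the reduction map).
* [deShalit1987] E. de Shalit, *Iwasawa theory of elliptic curves with complex multiplication* (1987), II §1.10, II §4.4
  (division points of `𝔭`-power level lie in the formal group at `𝔭`).
-/

noncomputable section

open scoped Classical NNReal

namespace Literature.NumberTheory.EllipticCurves.Cm7Kernel

open Literature.NumberTheory.EllipticCurves.FormalGroupChart _root_.WeierstrassCurve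

variable {F : Type*} [Field F] {w : Valuation F ℝ≥0} {V : WeierstrassCurve F}

/-! ## §0 Valuation bookkeeping for the model `[1, −1, 0, −2, −1]` -/

section Model

/-- The affine equation of the model `[1, −1, 0, −2, −1]`: `y² + xy = x³ − x² − 2x − 1`. [cite: SilvermanAEC2009, III.1] -/
theorem equation_cm7 (hV7 : V.a₁ = 1 ∧ V.a₂ = -1 ∧ V.a₃ = 0 ∧ V.a₄ = -2 ∧ V.a₆ = -1) {x y : F}
    (h : V.toAffine.Equation x y) : y ^ 2 + x * y = x ^ 3 - x ^ 2 - 2 * x - 1 := by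
  rw [Affine.equation_iff] at h
  obtain ⟨h1, h2, h3, h4, h6⟩ := hV7
  rw [h1, h2, h3, h4, h6] at h
  linear_combination h

/-- `negY x y = −y − x` on the model. [cite: SilvermanAEC2009, III.2.3] -/
theorem negY_cm7 (hV7 : V.a₁ = 1 ∧ V.a₂ = -1 ∧ V.a₃ = 0 ∧ V.a₄ = -2 ∧ V.a₆ = -1) (x y : F) :
    V.toAffine.negY x y = -y - x := by
  simp only [Affine.negY, hV7.1, hV7.2.2.1]; ring

/-- `w 3 = 1` when `w 2 < 1`. [folklore] -/
private theorem val_three (h2 : w 2 < 1) : w 3 = 1 := by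
  rw [show (3 : F) = 1 + 2 by norm_num]; exact w.map_one_add_of_lt h2

/-- `w y ≤ 1` from `w (y + 1) < 1`. [folklore] -/
private theorem val_le_one_of_val_add_one_lt {y : F} (hy : w (y + 1) < 1) : w y ≤ 1 := by
  rw [show y = (y + 1) - 1 by ring]
  exact w.map_sub_le hy.le (by rw [Valuation.map_one])

/-- **Integral `x` forces integral `y`** on the model: `w x ≤ 1 ⟹ w y ≤ 1` (else `y²` dominates the equation). [cite: SilvermanAEC2009, VII.2.2] -/
theorem val_y_le_one (h2 : w 2 < 1) {x y : F} (he : y ^ 2 + x * y = x ^ 3 - x ^ 2 - 2 * x - 1) (hx : w x ≤ 1) :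
    w y ≤ 1 := by
  by_contra hy
  push Not at hy
  have hy0 : 0 < w y := zero_lt_one.trans hy
  have hlt : w (x * y) < w (y ^ 2) := by
    rw [Valuation.map_mul, Valuation.map_pow, sq]
    exact mul_lt_mul_of_pos_right (hx.trans_lt hy) hy0
  have hl : w (y ^ 2 + x * y) = w y ^ 2 := by
    rw [w.map_add_eq_of_lt_left hlt, Valuation.map_pow]
  have hr : w (x ^ 3 - x ^ 2 - 2 * x - 1) ≤ 1 := by
    refine w.map_sub_le (w.map_sub_le (w.map_sub_le ?_ ?_) ?_) (by rw [Valuation.map_one])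
    · rw [Valuation.map_pow]; exact pow_le_one₀ bot_le hx
    · rw [Valuation.map_pow]; exact pow_le_one₀ bot_le hx
    · rw [Valuation.map_mul]; exact mul_le_one' h2.le hx
  rw [he] at hl
  have : (1 : ℝ≥0) < w y ^ 2 := one_lt_pow₀ hy two_ne_zero
  exact absurd (hl ▸ hr) (not_le.mpr this)

/-- **`2y + x ≡ 0` forces `P ≡ (0, 1)`**: on the model, `w x ≤ 1`, `w y ≤ 1` and `w (2y + x) < 1` give `w x < 1` and
`w (y + 1) < 1` (`x = (2y + x) − 2y`, `(y + 1)² = x(x² − x − 2 − y) + 2y`). [cite: SilvermanAEC2009, VII.2.1] -/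
theorem val_lt_one_of_val_two_y_add_x_lt (h2 : w 2 < 1) {x y : F} (he : y ^ 2 + x * y = x ^ 3 - x ^ 2 - 2 * x - 1)
    (hx : w x ≤ 1) (hy : w y ≤ 1) (hd : w (2 * y + x) < 1) : w x < 1 ∧ w (y + 1) < 1 := by
  have h2y : w (2 * y) < 1 := by
    rw [Valuation.map_mul]; exact mul_lt_one_of_nonneg_of_lt_one_left bot_le h2 hy
  have hx1 : w x < 1 := by
    rw [show x = (2 * y + x) - 2 * y by ring]
    exact w.map_sub_lt hd h2y
  refine ⟨hx1, ?_⟩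
  have hsq : (y + 1) ^ 2 = x * (x ^ 2 - x - 2 - y) + 2 * y := by linear_combination he
  have hb : w (x ^ 2 - x - 2 - y) ≤ 1 :=
    w.map_sub_le (w.map_sub_le (w.map_sub_le
      (by rw [Valuation.map_pow]; exact pow_le_one₀ bot_le hx) hx) h2.le) hy
  have h1 : w ((y + 1) ^ 2) < 1 := by
    rw [hsq]
    refine w.map_add_lt ?_ h2y
    rw [Valuation.map_mul]
    exact mul_lt_one_of_nonneg_of_lt_one_left bot_le hx1 hb
  rw [Valuation.map_pow] at h1
  exact (pow_lt_one_iff_of_nonneg bot_le two_ne_zero).mp h1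

/-- `1 < w (N / D)` when `w N = 1`, `D ≠ 0`, `w D < 1`. [folklore] -/
private theorem one_lt_val_div {N D : F} (hN : w N = 1) (hD0 : D ≠ 0) (hD : w D < 1) : 1 < w (N / D) := by
  rw [Valuation.map_div, hN, one_div]
  exact (one_lt_inv₀ (pos_iff_ne_zero.mpr ((Valuation.ne_zero_iff w).mpr hD0))).mpr hD

/-- `w (−1 + b) = 1` when `w b < 1`. [folklore] -/
private theorem val_neg_one_add {b : F} (hb : w b < 1) : w (-1 + b) = 1 := by
  rw [w.map_add_eq_of_lt_left (by rwa [Valuation.map_neg, Valuation.map_one]), Valuation.map_neg,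
    Valuation.map_one]

/-- **A slope of valuation `> 1` puts the sum in `E₁`**: `1 < w ℓ`, `w x₁ ≤ 1`, `w x₂ ≤ 1 ⟹ 1 < w (addX x₁ x₂ ℓ)`
(`addX = ℓ² + ℓ + 1 − x₁ − x₂` on the model, dominated by `ℓ²`). [cite: SilvermanAEC2009, III.2.3] -/
theorem one_lt_val_addX (hV7 : V.a₁ = 1 ∧ V.a₂ = -1 ∧ V.a₃ = 0 ∧ V.a₄ = -2 ∧ V.a₆ = -1) {x₁ x₂ ℓ : F}
    (hℓ : 1 < w ℓ) (hx₁ : w x₁ ≤ 1) (hx₂ : w x₂ ≤ 1) : 1 < w (V.toAffine.addX x₁ x₂ ℓ) := by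
  have hX : V.toAffine.addX x₁ x₂ ℓ = ℓ ^ 2 + (ℓ + 1 - x₁ - x₂) := by
    simp only [Affine.addX, hV7.1, hV7.2.1]; ring
  have hrest : w (ℓ + 1 - x₁ - x₂) ≤ w ℓ :=
    w.map_sub_le (w.map_sub_le (w.map_add_le le_rfl (by rw [Valuation.map_one]; exact hℓ.le))
      (hx₁.trans hℓ.le)) (hx₂.trans hℓ.le)
  have hlt : w (ℓ + 1 - x₁ - x₂) < w (ℓ ^ 2) := by
    rw [Valuation.map_pow, sq]
    exact hrest.trans_lt (lt_mul_of_one_lt_left (zero_lt_one.trans hℓ) hℓ)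
  rw [hX, w.map_add_eq_of_lt_left hlt, Valuation.map_pow]
  exact one_lt_pow₀ hℓ two_ne_zero

end Model

/-! ## §1 Halving and addition of points `≡ (0, 1)` -/

section Chart

variable [hV : V.IsIntegral w.integer]

/-- ★ **Halving**: on the model with `w 2 < 1`, an affine point `P = (x, y) ∉ E₁` with `P + P ∈ E₁` (including `2P = O`)
satisfies `w x < 1` and `w (y + 1) < 1` — i.e. `P` reduces to the unique nonzero `2`-torsion point `(0, 1)` of the
ordinary reduction `ȳ² + x̄ȳ = x̄³ + x̄² + 1`.  (`2P = O`: `2y + x = 0`; else the tangent slope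
`(3x² − 2x − 2 − y)/(2y + x)` must have `w > 1`, so `w (2y + x) < 1`.) [cite: SilvermanAEC2009, VII.2.1–VII.2.2] -/
theorem val_lt_one_of_not_mem_of_add_self_mem {dec : DecidableEq F}
    (hV7 : V.a₁ = 1 ∧ V.a₂ = -1 ∧ V.a₃ = 0 ∧ V.a₄ = -2 ∧ V.a₆ = -1) (h2 : w 2 < 1)
    {x y : F} {h : V.toAffine.Nonsingular x y} (hP : (.some x y h : V.toAffine.Point) ∉ kernel w V)
    (h2P : (.some x y h : V.toAffine.Point) + .some x y h ∈ kernel w V) : w x < 1 ∧ w (y + 1) < 1 := by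
  obtain rfl : dec = fun a b => Classical.propDecidable (a = b) := Subsingleton.elim _ _
  have hx : w x ≤ 1 := not_lt.mp fun hx => hP (some_mem_kernel h hx)
  have he := equation_cm7 hV7 h.left
  have hy : w y ≤ 1 := val_y_le_one h2 he hx
  have hnegY := negY_cm7 hV7 x y
  by_cases hneg : y = V.toAffine.negY x y
  · -- `2P = O`: `2y + x = 0`
    refine val_lt_one_of_val_two_y_add_x_lt h2 he hx hy ?_
    rw [show 2 * y + x = 0 by rw [hnegY] at hneg; linear_combination hneg, Valuation.map_zero]
    exact zero_lt_one
  · rw [Affine.Point.add_self_of_Y_ne hneg] at h2P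
    have hk : 1 < w (V.toAffine.addX x x (V.toAffine.slope x x y y)) := (some_mem_kernel_iff _).mp h2P
    set ℓ := V.toAffine.slope x x y y with hℓdef
    have hℓ : ℓ = (3 * x ^ 2 - 2 * x - 2 - y) / (2 * y + x) := by
      rw [hℓdef, Affine.slope_of_Y_ne rfl hneg, hnegY, hV7.1, hV7.2.1, hV7.2.2.2.1]; ring
    -- `w ℓ > 1`
    have hℓ1 : 1 < w ℓ := by
      by_contra hle
      push Not at hle
      have : w (V.toAffine.addX x x ℓ) ≤ 1 := by
        have hX : V.toAffine.addX x x ℓ = ℓ ^ 2 + ℓ + 1 - x - x := by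
          simp only [Affine.addX, hV7.1, hV7.2.1]; ring
        rw [hX]
        refine w.map_sub_le (w.map_sub_le (w.map_add_le (w.map_add_le ?_ hle)
          (by rw [Valuation.map_one])) hx) hx
        rw [Valuation.map_pow]; exact pow_le_one₀ bot_le hle
      exact absurd hk (not_lt.mpr this)
    -- hence `w (2y + x) < 1`
    have hD0 : 2 * y + x ≠ 0 := by
      intro h0; apply hneg; rw [hnegY]; linear_combination h0
    have hN : w (3 * x ^ 2 - 2 * x - 2 - y) ≤ 1 := by
      refine w.map_sub_le (w.map_sub_le (w.map_sub_le ?_ ?_) h2.le) hy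
      · rw [Valuation.map_mul, val_three h2, one_mul, Valuation.map_pow]; exact pow_le_one₀ bot_le hx
      · rw [Valuation.map_mul]; exact mul_le_one' h2.le hx
    have hD : w (2 * y + x) < 1 := by
      by_contra hge
      push Not at hge
      have hwD : w (2 * y + x) ≠ 0 := (Valuation.ne_zero_iff w).mpr hD0
      have hprod : w ℓ * w (2 * y + x) = w (3 * x ^ 2 - 2 * x - 2 - y) := by
        rw [hℓ, Valuation.map_div, div_mul_cancel₀ _ hwD]
      have : w ℓ ≤ 1 :=
        (le_mul_of_one_le_right bot_le hge).trans (hprod.le.trans hN)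
      exact absurd hℓ1 (not_lt.mpr this)
    exact val_lt_one_of_val_two_y_add_x_lt h2 he hx hy hD

/-- ★ **Two points `≡ (0, 1)` add into `E₁`**: on the model with `w 2 < 1`, if `w xᵢ < 1` and `w (yᵢ + 1) < 1` (`i = 1, 2`)
then `(x₁, y₁) + (x₂, y₂) ∈ E₁`.  (Tangent case: slope `(3x₁² − 2x₁ − 2 − y₁)/(2y₁ + x₁)`; chord case: the curve equations
give `(y₁ − y₂)(y₁ + y₂ + x₁) = (x₁ − x₂)(x₁² + x₁x₂ + x₂² − x₁ − x₂ − 2 − y₂)`, so the slope is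
`(x₁² + ⋯ − 2 − y₂)/(y₁ + y₂ + x₁)`; in both cases numerator `≡ −1`, denominator `≡ 0`, so `w(slope) > 1`.)
[cite: SilvermanAEC2009, III.2.3, VII.2.1] -/
theorem add_mem_kernel_of_val_lt_one {dec : DecidableEq F}
    (hV7 : V.a₁ = 1 ∧ V.a₂ = -1 ∧ V.a₃ = 0 ∧ V.a₄ = -2 ∧ V.a₆ = -1) (h2 : w 2 < 1)
    {x₁ y₁ x₂ y₂ : F} {h₁ : V.toAffine.Nonsingular x₁ y₁} {h₂ : V.toAffine.Nonsingular x₂ y₂}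
    (hx₁ : w x₁ < 1) (hy₁ : w (y₁ + 1) < 1) (hx₂ : w x₂ < 1) (hy₂ : w (y₂ + 1) < 1) :
    (.some x₁ y₁ h₁ : V.toAffine.Point) + .some x₂ y₂ h₂ ∈ kernel w V := by
  obtain rfl : dec = fun a b => Classical.propDecidable (a = b) := Subsingleton.elim _ _
  by_cases hxy : x₁ = x₂ ∧ y₁ = V.toAffine.negY x₂ y₂
  · rw [Affine.Point.add_of_Y_eq hxy.1 hxy.2]; exact (kernel w V).zero_mem
  rw [Affine.Point.add_some hxy]
  apply some_mem_kernel
  have he₁ := equation_cm7 hV7 h₁.left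
  have he₂ := equation_cm7 hV7 h₂.left
  have hy₁' := val_le_one_of_val_add_one_lt hy₁
  have hy₂' := val_le_one_of_val_add_one_lt hy₂
  refine one_lt_val_addX hV7 ?_ hx₁.le hx₂.le
  by_cases hx : x₁ = x₂
  · -- tangent case (`y₁ = y₂`)
    have hy : y₁ ≠ V.toAffine.negY x₂ y₂ := fun h' => hxy ⟨hx, h'⟩
    have hyy : y₁ = y₂ := Affine.Y_eq_of_Y_ne h₁.left h₂.left hx hy
    subst hx; subst hyy
    rw [Affine.slope_of_Y_ne rfl hy,
      show 3 * x₁ ^ 2 + 2 * V.a₂ * x₁ + V.a₄ - V.a₁ * y₁ = -1 + (3 * x₁ ^ 2 - 2 * x₁ - (y₁ + 1)) by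
        rw [hV7.1, hV7.2.1, hV7.2.2.2.1]; ring,
      show y₁ - V.toAffine.negY x₁ y₁ = 2 * y₁ + x₁ by rw [negY_cm7 hV7]; ring]
    refine one_lt_val_div (val_neg_one_add ?_) ?_ ?_
    · refine w.map_sub_lt (w.map_sub_lt ?_ ?_) hy₁
      · rw [Valuation.map_mul, val_three h2, one_mul, Valuation.map_pow]
        exact (pow_lt_one_iff_of_nonneg bot_le two_ne_zero).mpr hx₁
      · rw [Valuation.map_mul]; exact mul_lt_one_of_nonneg_of_lt_one_left bot_le h2 hx₁.le
    · intro h0; apply hy; rw [negY_cm7 hV7]; linear_combination h0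
    · refine w.map_add_lt ?_ hx₁
      rw [Valuation.map_mul]; exact mul_lt_one_of_nonneg_of_lt_one_left bot_le h2 hy₁'
  · -- chord case
    have hid : (y₁ - y₂) * (y₁ + y₂ + x₁) = (x₁ ^ 2 + x₁ * x₂ + x₂ ^ 2 - x₁ - x₂ - 2 - y₂) * (x₁ - x₂) := by
      linear_combination he₁ - he₂
    have hN : w (x₁ ^ 2 + x₁ * x₂ + x₂ ^ 2 - x₁ - x₂ - 2 - y₂) = 1 := by
      rw [show x₁ ^ 2 + x₁ * x₂ + x₂ ^ 2 - x₁ - x₂ - 2 - y₂ = -1 + (x₁ ^ 2 + x₁ * x₂ + x₂ ^ 2 - x₁ - x₂ - (y₂ + 1)) by ring]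
      refine val_neg_one_add (w.map_sub_lt (w.map_sub_lt (w.map_sub_lt
        (w.map_add_lt (w.map_add_lt ?_ ?_) ?_) hx₁) hx₂) hy₂)
      · rw [Valuation.map_pow]; exact (pow_lt_one_iff_of_nonneg bot_le two_ne_zero).mpr hx₁
      · rw [Valuation.map_mul]; exact mul_lt_one_of_nonneg_of_lt_one_left bot_le hx₁ hx₂.le
      · rw [Valuation.map_pow]; exact (pow_lt_one_iff_of_nonneg bot_le two_ne_zero).mpr hx₂
    have hD : w (y₁ + y₂ + x₁) < 1 := by
      rw [show y₁ + y₂ + x₁ = ((y₁ + 1) + (y₂ + 1) + x₁) - 2 by ring]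
      exact w.map_sub_lt (w.map_add_lt (w.map_add_lt hy₁ hy₂) hx₁) h2
    have hx0 : x₁ - x₂ ≠ 0 := sub_ne_zero.mpr hx
    have hD0 : y₁ + y₂ + x₁ ≠ 0 := by
      intro h0
      rw [h0, mul_zero] at hid
      have := (mul_eq_zero.mp hid.symm).resolve_right hx0
      rw [this, Valuation.map_zero] at hN
      exact zero_ne_one hN
    rw [Affine.slope_of_X_ne hx, (div_eq_div_iff hx0 hD0).mpr hid]
    exact one_lt_val_div hN hD0 hD

end Chart

/-! ## §2 Descent: `E₁`-membership from the non-membership of translates -/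

section Descent

variable [hV : V.IsIntegral w.integer]

/-- ★★ **Descent**: on the model with `w 2 < 1`, let `R ≠ O`, `2 • R = O`, `R ∉ E₁`, and let `P₀` satisfy `2^N • P₀ = O`.
If no translate `2^i • P₀ + R` with `i < N` lies in `E₁`, then `P₀ ∈ E₁`.  (Take `j` minimal with `2^j P₀ ∈ E₁`; if
`j = i + 1 > 0` then `P = 2^i P₀ ∉ E₁` with `2P ∈ E₁`, so `P ≡ (0,1) ≡ R` by halving and `P + R ∈ E₁` by §1 — excluded.)
[cite: SilvermanAEC2009, VII.2.1–VII.2.2] -/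
theorem mem_kernel_of_forall_not_mem {dec : DecidableEq F}
    (hV7 : V.a₁ = 1 ∧ V.a₂ = -1 ∧ V.a₃ = 0 ∧ V.a₄ = -2 ∧ V.a₆ = -1) (h2 : w 2 < 1)
    {R : V.toAffine.Point} (hR0 : R ≠ 0) (hR2 : 2 • R = 0) (hRk : R ∉ kernel w V)
    {P₀ : V.toAffine.Point} {N : ℕ} (hN : 2 ^ N • P₀ = 0)
    (hstep : ∀ i < N, 2 ^ i • P₀ + R ∉ kernel w V) : P₀ ∈ kernel w V := by
  obtain rfl : dec = fun a b => Classical.propDecidable (a = b) := Subsingleton.elim _ _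
  by_contra h0
  have hex : ∃ j, 2 ^ j • P₀ ∈ kernel w V := ⟨N, by rw [hN]; exact (kernel w V).zero_mem⟩
  have hj0 : Nat.find hex ≠ 0 := by
    intro hz
    have hsp : 2 ^ Nat.find hex • P₀ ∈ kernel w V := Nat.find_spec hex
    rw [hz, pow_zero, one_smul] at hsp
    exact h0 hsp
  obtain ⟨i, hi⟩ : ∃ i, Nat.find hex = i + 1 := Nat.exists_eq_succ_of_ne_zero hj0
  have hiN : i < N := by
    have := Nat.find_le (h := hex) (n := N) (by rw [hN]; exact (kernel w V).zero_mem)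
    omega
  have hP : 2 ^ i • P₀ ∉ kernel w V := Nat.find_min hex (by omega)
  have h2P : 2 ^ i • P₀ + 2 ^ i • P₀ ∈ kernel w V := by
    have hsp : 2 ^ Nat.find hex • P₀ ∈ kernel w V := Nat.find_spec hex
    rw [hi, pow_succ, mul_comm, mul_smul, two_smul] at hsp
    assumption
  -- `P = 2^i P₀` and `R` are affine points `≡ (0, 1)`
  rcases hPe : (2 ^ i • P₀) with _ | ⟨x, y, h⟩
  · rw [hPe] at hP; exact hP (kernel w V).zero_mem
  rw [hPe] at hP h2P
  obtain ⟨hx, hy⟩ := val_lt_one_of_not_mem_of_add_self_mem hV7 h2 hP h2P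
  rcases hRe : R with _ | ⟨x', y', h'⟩
  · exact hR0 hRe
  rw [hRe] at hRk hR2
  rw [two_smul] at hR2
  obtain ⟨hx', hy'⟩ := val_lt_one_of_not_mem_of_add_self_mem hV7 h2 hRk (by rw [hR2]; exact (kernel w V).zero_mem)
  -- so `P + R ∈ E₁` — excluded
  have hsum : (.some x y h : V.toAffine.Point) + .some x' y' h' ∈ kernel w V :=
    add_mem_kernel_of_val_lt_one hV7 h2 hx hy hx' hy'
  have hfin : 2 ^ i • P₀ + R ∈ kernel w V := by rw [hPe, hRe]; assumption
  exact hstep i hiN hfin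

/-- `R ∉ E₁` from an operator on `E₁` that FIXES `R` and KILLS `R` (in the lane: `[π]_{P′}` acting through the chart —
`P([π] z(ι_vξ(ū))) = ι_vξ(π₀ū) = ι_vξ(ū)`, while `[π]_{P′}` kills the `2`-torsion of `E₁`; `R ≠ O`). [cite: deShalit1987, II §4.4] -/
theorem not_mem_kernel_of_fixed_of_killed {R : V.toAffine.Point} (hR0 : R ≠ 0)
    (Φ : ∀ P : V.toAffine.Point, P ∈ kernel w V → V.toAffine.Point)
    (hfix : ∀ hR : R ∈ kernel w V, Φ R hR = R) (hkill : ∀ hR : R ∈ kernel w V, Φ R hR = 0) : R ∉ kernel w V :=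
  fun hR => hR0 ((hfix hR).symm.trans (hkill hR))

end Descent

/-! ## §3 (N1): the division-point readings lie in `E₁` -/

section DivisionPoints

variable [hV : V.IsIntegral w.integer]

/-- ★★★ **(N1) — `E₁`-membership of the `𝔭`-power division points by CM descent.**  On the model `[1, −1, 0, −2, −1]` over a
valued field with `w 2 < 1`: let `Y 0, …, Y m` be points with `2^{n+1} • Y n = O` (`n ≤ m`), `R ≠ O` a point with
`2 • R = O` and `R ∉ E₁`, such that `Y 0 + R ∉ E₁` and, for `n < m` and `0 < k < 2^{n+2}`,
`k • Y (n+1) + R ∈ E₁ ⟹ k • Y n + R ∈ E₁` (DESCENT).  Then `Y n ∈ E₁` for every `n ≤ m`.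
In the lane (`Y n = ι_vξ(u_{n+1})`, `R = ι_vξ(ū)`): DESCENT and `Y 0 + R ∉ E₁` are the `[π]`-coherence
`P([π]_{P′} z(U′)) = ι_vξ(π₀z)` of `CMFormalActionLaneCoherence` at `U′ = ι_vξ(k u_{n+2} + ū)` resp. `ι_vξ(u₁ + ū)`
(`π₀u_{n+2} ≡ u_{n+1}`, `π₀u₁ ≡ 0`, `π₀ū ≡ ū (mod L)`; `P(·) ∈ E₁`, `R ∉ E₁`), and `R ∉ E₁` is
`not_mem_kernel_of_fixed_of_killed`; the conclusion at `n = m` is the hypothesis `hU` of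
`exists_unit_relColemanSeries_eq_subst_subst_of_divisionPoints`. [cite: deShalit1987, II §1.10, II §4.4] [cite: SilvermanAEC2009, VII.2.2] -/
theorem forall_mem_kernel_of_cmDescent {dec : DecidableEq F}
    (hV7 : V.a₁ = 1 ∧ V.a₂ = -1 ∧ V.a₃ = 0 ∧ V.a₄ = -2 ∧ V.a₆ = -1) (h2 : w 2 < 1)
    {R : V.toAffine.Point} (hR0 : R ≠ 0) (hR2 : 2 • R = 0) (hRk : R ∉ kernel w V)
    (Y : ℕ → V.toAffine.Point) {m : ℕ} (htor : ∀ n ≤ m, 2 ^ (n + 1) • Y n = 0)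
    (h₀ : Y 0 + R ∉ kernel w V)
    (hdesc : ∀ n < m, ∀ k : ℕ, 0 < k → k < 2 ^ (n + 2) →
      k • Y (n + 1) + R ∈ kernel w V → k • Y n + R ∈ kernel w V) :
    ∀ n ≤ m, Y n ∈ kernel w V := by
  obtain rfl : dec = fun a b => Classical.propDecidable (a = b) := Subsingleton.elim _ _
  intro n
  induction n with
  | zero =>
    intro _
    have key : ∀ i < 1, 2 ^ i • Y 0 + R ∉ kernel w V := by
      intro i hi
      obtain rfl : i = 0 := by omega
      rwa [pow_zero, one_smul]
    exact @mem_kernel_of_forall_not_mem F _ w V hV _ hV7 h2 R hR0 hR2 hRk (Y 0) 1 (htor 0 (Nat.zero_le _)) key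
  | succ n ih =>
    intro hn
    have ih' : Y n ∈ kernel w V := ih (by omega)
    have key : ∀ i < n + 2, 2 ^ i • Y (n + 1) + R ∉ kernel w V := by
      intro i hi hmem
      have hk : 2 ^ i • Y n + R ∈ kernel w V :=
        hdesc n (by omega) (2 ^ i) (by positivity) (Nat.pow_lt_pow_right (by norm_num) hi) hmem
      have hK : 2 ^ i • Y n ∈ kernel w V := (kernel w V).nsmul_mem ih' _
      have hR : 2 ^ i • Y n + R - 2 ^ i • Y n ∈ kernel w V := (kernel w V).sub_mem hk hK
      rw [add_sub_cancel_left] at hR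
      exact hRk hR
    exact @mem_kernel_of_forall_not_mem F _ w V hV _ hV7 h2 R hR0 hR2 hRk (Y (n + 1)) (n + 2) (htor (n + 1) hn) key

/-- **(N1), top level only** — the form consumed per level `m` (`U m := Y m`). [cite: deShalit1987, II §4.4] -/
theorem mem_kernel_of_cmDescent {dec : DecidableEq F}
    (hV7 : V.a₁ = 1 ∧ V.a₂ = -1 ∧ V.a₃ = 0 ∧ V.a₄ = -2 ∧ V.a₆ = -1) (h2 : w 2 < 1)
    {R : V.toAffine.Point} (hR0 : R ≠ 0) (hR2 : 2 • R = 0) (hRk : R ∉ kernel w V)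
    (Y : ℕ → V.toAffine.Point) {m : ℕ} (htor : ∀ n ≤ m, 2 ^ (n + 1) • Y n = 0)
    (h₀ : Y 0 + R ∉ kernel w V)
    (hdesc : ∀ n < m, ∀ k : ℕ, 0 < k → k < 2 ^ (n + 2) →
      k • Y (n + 1) + R ∈ kernel w V → k • Y n + R ∈ kernel w V) :
    Y m ∈ kernel w V :=
  @forall_mem_kernel_of_cmDescent F _ w V hV dec hV7 h2 R hR0 hR2 hRk Y m htor h₀ hdesc m le_rfl

end DivisionPoints

end Literature.NumberTheory.EllipticCurves.Cm7Kernel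

end
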